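import Mathlib.Topology.MetricSpace.HausdorffDistance
import Literature.Probability.RandomPlanarGeometry.SimpleCurves
import Summits.CriticalPhenomena.SAWScalingLimit.Theorems.SAWDevelopingMapHexConjectureCurveUpgradeCrossing
import Summits.CriticalPhenomena.SAWScalingLimit.Theorems.SAWDevelopingMapHexConjectureCurveUpgradeProjection

/-!
# Curve upgrade, part 1c: the deterministic lemma — close to the arc, or a triple strand

Support file for the crux `HexConjecture` (stmt-CriticalPhenomena-0808, Duminil-Copin–Smirnov 2012
Conjecture 1), line `root-locality-replaces-loewner`, stub `stub_curveUpgrade` (ABSTRACT upgrade of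
range convergence to curve convergence in `CurveClass ℂ`). Namespace `…RootLocality.Upgrade`.
This is PART 1 of the stub (pure topology of curves, all metric spaces):

* `exists_monotone_majorant` — a continuous `q : [0,1] → [0,1]`, `q 0 = 0`, `q 1 = 1`, WITHOUT an
  `H`-backtrack (`q x < q y + H` for `x ≤ y`) is within `H` of its running maximum `m`, a monotone
  continuous map of `[0,1]` onto itself (the running maximum is the tree's `Curve.runSup` of `q`
  viewed as a curve in `ℝ`);
* `dist_le_of_noBacktrack` — hence a curve `c` with `dist (c t) (η (q t)) ≤ ε₁` is within
  `ε₁ + osc_η(H)` of `η` in the reparametrisation distance (`η ∘ m` is a monotone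
  reparametrisation of `η`, at distance `0`: `Curve.dist_precomp_eq_zero`);
* `dist_le_or_exists_strands` — DICHOTOMY: either that, or (`exists_three_crossings`, part 1a) three
  parameter-disjoint intervals of `c` on each of which `q` maps onto a common `[L₁, L₂]` with
  `L₂ - L₁ ≥ H/2`;
* `diam_and_hausdorffDist_of_strands` — such intervals are three sub-arcs of `c` pairwise within
  Hausdorff distance `2ε₁`, of diameter `≥ dist (η L₁) (η L₂) - 2ε₁`;
* **`dist_le_or_tripleStrand`** (registered helper = PART 1 of the stub, plane case): for curves
  `c, η` with the trace of `c` within `ε` of the trace of `η`, `ε`-close endpoints, and explicit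
  injectivity / continuity moduli of `η` as hypotheses, EITHER `dist c η ≤ ε + β + r₁ + r₂` OR `c`
  has a `(2(ε + β + r₁), d - 2(ε + β + r₁))`-triple strand in the exact inlined form of the line's
  event `HasTripleStrand` (part 1b supplies the continuous approximate projection `q`).

Folklore (Aizenman–Burchard 1999 §2 bookkeeping; intermediate value theorem); no named fact used.
-/

noncomputable section

open Set Metric
open scoped unitInterval

namespace Summit.CriticalPhenomena.SAWScalingLimit.Theorems.HexConjecture.RootLocality.Upgrade

open Literature.Probability.RandomPlanarGeometry

variable {E : Type*} [PseudoMetricSpace E]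

/-- **Running maximum.** A continuous `q : [0,1] → [0,1]` with `q 0 = 0`, `q 1 = 1` and no
`H`-backtrack (`q x < q y + H` whenever `x ≤ y`) admits a monotone continuous `m : [0,1] → [0,1]`,
`m 0 = 0`, `m 1 = 1`, with `q ≤ m ≤ q + H` pointwise (its running maximum, realised as the running
oscillation `Curve.runSup` of `q` viewed as a curve in `ℝ`). [folklore] -/
theorem exists_monotone_majorant {q : I → I} (hq : Continuous q) (hq0 : q 0 = 0) (hq1 : q 1 = 1)
    {H : ℝ} (hnb : ∀ x y : I, x ≤ y → (q x : ℝ) < q y + H) :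
    ∃ m : C(I, I), Monotone m ∧ m 0 = 0 ∧ m 1 = 1 ∧
      ∀ t, (q t : ℝ) ≤ m t ∧ (m t : ℝ) ≤ q t + H := by
  let qc : Curve ℝ := ⟨⟨fun t ↦ (q t : ℝ), continuous_subtype_val.comp hq⟩⟩
  have hqc : ∀ u, qc u = (q u : ℝ) := fun u ↦ rfl
  have hdist : ∀ u, dist (qc 0) (qc u) = (q u : ℝ) := by
    intro u
    rw [hqc, hqc, hq0, Real.dist_eq, show ((0 : I) : ℝ) = (0 : ℝ) from rfl, zero_sub, abs_neg,
      abs_of_nonneg (q u).2.1]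
  have hle1 : ∀ t, qc.runSup 0 t ≤ 1 := fun t ↦
    qc.runSup_le zero_le_one fun u _ _ ↦ by rw [hdist]; exact (q u).2.2
  have hmem : ∀ t, qc.runSup 0 t ∈ I := fun t ↦ ⟨qc.runSup_nonneg 0 t, hle1 t⟩
  let m : C(I, I) := ⟨fun t ↦ ⟨qc.runSup 0 t, hmem t⟩, (qc.continuous_runSup 0).subtype_mk _⟩
  have hm : ∀ t, ((m t : I) : ℝ) = qc.runSup 0 t := fun t ↦ rfl
  refine ⟨m, fun s t hst ↦ ?_, ?_, ?_, fun t ↦ ⟨?_, ?_⟩⟩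
  · show qc.runSup 0 s ≤ qc.runSup 0 t
    exact qc.runSup_mono 0 hst
  · apply Subtype.ext
    rw [hm]
    refine le_antisymm (qc.runSup_le le_rfl fun u h0u hu0 ↦ ?_) (qc.runSup_nonneg 0 0)
    rw [le_antisymm hu0 h0u, dist_self]
    exact le_rfl
  · apply Subtype.ext
    rw [hm]
    refine le_antisymm (hle1 1) ?_
    have h := qc.le_runSup (a := 0) (u := 1) (t := 1) bot_le le_rfl
    rwa [hdist, hq1] at h
  · rw [hm, ← hdist]
    exact qc.le_runSup bot_le le_rfl
  · rw [hm]
    have hH : 0 < H := by linarith [hnb t t le_rfl]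
    refine qc.runSup_le (by linarith [(q t).2.1]) fun u _ hut ↦ ?_
    rw [hdist]
    exact (hnb u t hut).le

/-- **No backtrack ⟹ close.** If `dist (c t) (η (q t)) ≤ ε₁` for a continuous `q : [0,1] → [0,1]`
with `q 0 = 0`, `q 1 = 1` and no `H`-backtrack, and `η` moves by at most `r₂` over parameter
distance `H`, then `dist c η ≤ ε₁ + r₂` for the reparametrisation distance: `c` is uniformly
`ε₁ + r₂`-close to `η ∘ m` (`m` the running maximum of `q`), a monotone reparametrisation of `η`
at distance `0` from `η` (`Curve.dist_precomp_eq_zero`). [folklore] -/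
theorem dist_le_of_noBacktrack (c η : Curve E) {q : I → I} (hq : Continuous q) (hq0 : q 0 = 0)
    (hq1 : q 1 = 1) {ε₁ H r₂ : ℝ} (hclose : ∀ t, dist (c t) (η (q t)) ≤ ε₁)
    (hosc : ∀ u v : I, dist u v ≤ H → dist (η u) (η v) ≤ r₂)
    (hnb : ∀ x y : I, x ≤ y → (q x : ℝ) < q y + H) : dist c η ≤ ε₁ + r₂ := by
  obtain ⟨m, hmono, hm0, hm1, hm⟩ := exists_monotone_majorant hq hq0 hq1 hnb
  have hε₁ : 0 ≤ ε₁ := dist_nonneg.trans (hclose 0)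
  have hr₂ : 0 ≤ r₂ := dist_nonneg.trans (hosc 0 0 (by rw [dist_self]; linarith [hnb 0 0 le_rfl]))
  have h1 : dist c (η.precomp m) ≤ ε₁ + r₂ := by
    refine (Curve.dist_le_dist_toContinuousMap _ _).trans
      ((ContinuousMap.dist_le (by positivity)).2 fun t ↦ ?_)
    change dist (c t) (η (m t)) ≤ ε₁ + r₂
    have hqm : dist (q t) (m t) ≤ H := by
      rw [Subtype.dist_eq, Real.dist_eq, abs_le]
      constructor <;> linarith [(hm t).1, (hm t).2]
    calc dist (c t) (η (m t)) ≤ dist (c t) (η (q t)) + dist (η (q t)) (η (m t)) :=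
          dist_triangle _ _ _
      _ ≤ ε₁ + r₂ := add_le_add (hclose t) (hosc _ _ hqm)
  have h2 : dist (η.precomp m) η = 0 := Curve.dist_precomp_eq_zero η m hmono hm0 hm1
  linarith [dist_triangle c (η.precomp m) η]

/-- **Dichotomy.** For a continuous `q : [0,1] → [0,1]`, `q 0 = 0`, `q 1 = 1`, with
`dist (c t) (η (q t)) ≤ ε₁`, and `H > 0`: either `dist c η ≤ ε₁ + osc_η(H)`, or there are three
closed parameter intervals `[s i, t i]`, in order and pairwise disjoint, on each of which `q` maps
exactly onto a common `[L₁, L₂]` with `L₂ - L₁ ≥ H/2` (an `H`-backtrack of `q` and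
`exists_three_crossings`). [folklore] -/
theorem dist_le_or_exists_strands (c η : Curve E) {q : I → I} (hq : Continuous q) (hq0 : q 0 = 0)
    (hq1 : q 1 = 1) {ε₁ H r₂ : ℝ} (hH : 0 < H) (hclose : ∀ t, dist (c t) (η (q t)) ≤ ε₁)
    (hosc : ∀ u v : I, dist u v ≤ H → dist (η u) (η v) ≤ r₂) :
    dist c η ≤ ε₁ + r₂ ∨ ∃ s t : Fin 3 → I, (∀ i, s i ≤ t i) ∧ t 0 < s 1 ∧ t 1 < s 2 ∧
      ∃ L₁ L₂ : I, (L₁ : ℝ) + H / 2 ≤ L₂ ∧ ∀ i, q '' Icc (s i) (t i) = Icc L₁ L₂ := by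
  by_cases hnb : ∀ x y : I, x ≤ y → (q x : ℝ) < q y + H
  · exact Or.inl (dist_le_of_noBacktrack c η hq hq0 hq1 hclose hosc hnb)
  right
  push Not at hnb
  obtain ⟨x, y, hxy, hback⟩ := hnb
  -- the real-variable extension of `q` and the two levels
  set ψ : ℝ → ℝ := fun r ↦ ((q (projIcc 0 1 zero_le_one r) : I) : ℝ) with hψdef
  have hψc : Continuous ψ := continuous_subtype_val.comp (hq.comp continuous_projIcc)
  have hψval : ∀ a : I, ψ a = (q a : ℝ) := fun a ↦ by simp [hψdef, projIcc_val]
  set L₁ : ℝ := (q y : ℝ) + H / 4 with hL₁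
  set L₂ : ℝ := (q x : ℝ) - H / 4 with hL₂
  have hqy0 : (0 : ℝ) ≤ q y := (q y).2.1
  have hqx1 : (q x : ℝ) ≤ 1 := (q x).2.2
  have hL12 : L₁ + H / 2 ≤ L₂ := by rw [hL₁, hL₂]; linarith
  have hL : L₁ < L₂ := by linarith
  have hL₁0 : 0 ≤ L₁ := by rw [hL₁]; linarith
  have hL₂1 : L₂ ≤ 1 := by rw [hL₂]; linarith
  have hL₁mem : L₁ ∈ I := ⟨hL₁0, hL.le.trans hL₂1⟩
  have hL₂mem : L₂ ∈ I := ⟨hL₁0.trans hL.le, hL₂1⟩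
  have hψ0 : ψ 0 ≤ L₁ := by
    have : ψ ((0 : I) : ℝ) = (q 0 : ℝ) := hψval 0
    rw [show ((0 : I) : ℝ) = (0 : ℝ) from rfl, hq0] at this
    rw [this]; exact hL₁0
  have hψ1 : L₂ ≤ ψ 1 := by
    have : ψ ((1 : I) : ℝ) = (q 1 : ℝ) := hψval 1
    rw [show ((1 : I) : ℝ) = (1 : ℝ) from rfl, hq1] at this
    rw [this]; exact hL₂1
  have hψx : L₂ < ψ x := by rw [hψval, hL₂]; linarith
  have hψy : ψ y < L₁ := by rw [hψval, hL₁]; linarith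
  obtain ⟨s, t, hst, h01, h12, himg⟩ := exists_three_crossings ψ L₁ L₂ x y hψc hL hψ0 hψ1 x.2.1
    (Subtype.coe_le_coe.2 hxy) y.2.2 hψx hψy
  have hsmem : ∀ i, s i ∈ I := fun i ↦ ⟨(hst i).1, (hst i).2.1.trans (hst i).2.2⟩
  have htmem : ∀ i, t i ∈ I := fun i ↦ ⟨(hst i).1.trans (hst i).2.1, (hst i).2.2⟩
  refine ⟨fun i ↦ ⟨s i, hsmem i⟩, fun i ↦ ⟨t i, htmem i⟩, fun i ↦ (hst i).2.1, h01, h12,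
    ⟨L₁, hL₁mem⟩, ⟨L₂, hL₂mem⟩, hL12, fun i ↦ ?_⟩
  ext v
  constructor
  · rintro ⟨a, ha, rfl⟩
    have hav : (a : ℝ) ∈ Icc (s i) (t i) := ⟨Subtype.coe_le_coe.2 ha.1, Subtype.coe_le_coe.2 ha.2⟩
    have hψa : ψ a ∈ Icc L₁ L₂ := by rw [← himg i]; exact mem_image_of_mem ψ hav
    rw [hψval] at hψa
    exact ⟨Subtype.coe_le_coe.1 hψa.1, Subtype.coe_le_coe.1 hψa.2⟩
  · intro hv
    have hv' : (v : ℝ) ∈ Icc L₁ L₂ := ⟨Subtype.coe_le_coe.2 hv.1, Subtype.coe_le_coe.2 hv.2⟩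
    rw [← himg i] at hv'
    obtain ⟨r, hr, hrv⟩ := hv'
    have hrmem : r ∈ I := ⟨(hsmem i).1.trans hr.1, hr.2.trans (htmem i).2⟩
    refine ⟨⟨r, hrmem⟩, ⟨Subtype.coe_le_coe.1 hr.1, Subtype.coe_le_coe.1 hr.2⟩, Subtype.ext ?_⟩
    rw [← hrv, hψdef]
    simp only [projIcc_of_mem zero_le_one hrmem]

/-- **Three strands over a common sub-arc.** If `dist (c t) (η (q t)) ≤ ε₁` and `q` maps each of the
intervals `[s i, t i]` (`s i ≤ t i`) exactly onto `[L₁, L₂]`, `L₁ ≤ L₂`, then the three sub-arcs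
`c [s i, t i]` are pairwise within Hausdorff distance `2ε₁` (each is within `ε₁` of `η [L₁, L₂]`)
and have diameter `≥ dist (η L₁) (η L₂) - 2ε₁`. [folklore] -/
theorem diam_and_hausdorffDist_of_strands (c η : Curve E) {q : I → I} {ε₁ d : ℝ}
    {s t : Fin 3 → I} {L₁ L₂ : I} (hclose : ∀ t, dist (c t) (η (q t)) ≤ ε₁)
    (hst : ∀ i, s i ≤ t i) (hL : L₁ ≤ L₂) (himg : ∀ i, q '' Icc (s i) (t i) = Icc L₁ L₂)
    (hd : d ≤ dist (η L₁) (η L₂)) :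
    (∀ i, d - 2 * ε₁ ≤ diam ((⇑c) '' Icc (s i) (t i))) ∧
      ∀ i j, hausdorffDist ((⇑c) '' Icc (s i) (t i)) ((⇑c) '' Icc (s j) (t j)) ≤ 2 * ε₁ := by
  have hε₁ : 0 ≤ ε₁ := dist_nonneg.trans (hclose 0)
  set A : Fin 3 → Set E := fun i ↦ (⇑c) '' Icc (s i) (t i) with hA
  set B : Set E := (⇑η) '' Icc L₁ L₂ with hB
  have hAne : ∀ i, (A i).Nonempty := fun i ↦ (nonempty_Icc.2 (hst i)).image _
  have hBne : B.Nonempty := (nonempty_Icc.2 hL).image _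
  have hAbd : ∀ i, Bornology.IsBounded (A i) := fun i ↦
    (isCompact_range c.continuous).isBounded.subset (image_subset_range _ _)
  have hBbd : Bornology.IsBounded B :=
    (isCompact_range η.continuous).isBounded.subset (image_subset_range _ _)
  -- coverage: every level in `[L₁, L₂]` is attained on each interval
  have hcov : ∀ i, ∀ v ∈ Icc L₁ L₂, ∃ a ∈ Icc (s i) (t i), q a = v := fun i v hv ↦ by
    have : v ∈ q '' Icc (s i) (t i) := by rw [himg i]; exact hv
    exact this
  have hin : ∀ i, ∀ a ∈ Icc (s i) (t i), q a ∈ Icc L₁ L₂ := fun i a ha ↦ by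
    rw [← himg i]; exact mem_image_of_mem q ha
  have hH : ∀ i, hausdorffDist (A i) B ≤ ε₁ := by
    intro i
    refine hausdorffDist_le_of_mem_dist hε₁ ?_ ?_
    · rintro _ ⟨a, ha, rfl⟩
      exact ⟨η (q a), mem_image_of_mem _ (hin i a ha), hclose a⟩
    · rintro _ ⟨v, hv, rfl⟩
      obtain ⟨a, ha, hqa⟩ := hcov i v hv
      exact ⟨c a, mem_image_of_mem _ ha, by rw [dist_comm, ← hqa]; exact hclose a⟩
  refine ⟨fun i ↦ ?_, fun i j ↦ ?_⟩
  · obtain ⟨a₁, ha₁, hq₁⟩ := hcov i L₁ (left_mem_Icc.2 hL)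
    obtain ⟨a₂, ha₂, hq₂⟩ := hcov i L₂ (right_mem_Icc.2 hL)
    have h4 := dist_triangle4 (η L₁) (c a₁) (c a₂) (η L₂)
    have e1 : dist (η L₁) (c a₁) ≤ ε₁ := by rw [dist_comm, ← hq₁]; exact hclose a₁
    have e2 : dist (c a₂) (η L₂) ≤ ε₁ := by rw [← hq₂]; exact hclose a₂
    have e3 : dist (c a₁) (c a₂) ≤ diam (A i) :=
      dist_le_diam_of_mem (hAbd i) (mem_image_of_mem _ ha₁) (mem_image_of_mem _ ha₂)
    linarith
  · have hfin : hausdorffEDist (A i) B ≠ ⊤ :=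
      hausdorffEDist_ne_top_of_nonempty_of_bounded (hAne i) hBne (hAbd i) hBbd
    calc hausdorffDist (A i) (A j) ≤ hausdorffDist (A i) B + hausdorffDist B (A j) :=
          hausdorffDist_triangle hfin
      _ ≤ ε₁ + ε₁ := add_le_add (hH i) (by rw [hausdorffDist_comm]; exact hH j)
      _ = 2 * ε₁ := by ring

/-- **PART 1 of `stub_curveUpgrade` — the deterministic lemma (registered helper): close to the arc
modulo reparametrisation, or a triple strand.** Let `c, η : [0,1] → ℂ` be curves with every point
of `c` within `ε` of the trace of `η` and `ε`-close endpoints; let `β > 0`, `H > 0`, and let `η`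
have the injectivity modulus `dist (η u) (η v) ≤ 2ε + β ⟹ |u - v| ≤ τ`, the continuity moduli
`|u - v| ≤ τ ⟹ dist ≤ r₁`, `|u - v| ≤ H ⟹ dist ≤ r₂`, and the separation
`|u - v| ≥ H/2 ⟹ dist (η u) (η v) ≥ d`. Then EITHER `dist c η ≤ ε + β + r₁ + r₂`
(reparametrisation distance of `Curve ℂ`), OR `c` has three parameter intervals
`[s i, t i]`, in order and pairwise disjoint, whose images have diameter `≥ d - 2(ε + β + r₁)` and
are pairwise within Hausdorff distance `2(ε + β + r₁)` — the inlined `(ε', ℓ')`-triple-strand event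
of the line. (For a simple arc `η` all four moduli exist at every scale, so `ε + β + r₁ + r₂ → 0`
as `ε → 0` for fixed `H`, while `d = d(H) > 0`.) [folklore] -/
theorem dist_le_or_tripleStrand : ∀ (c η : Literature.Probability.RandomPlanarGeometry.Curve ℂ) (ε β τ r₁ H r₂ d : ℝ), 0 < β → 0 < H → (∀ t : unitInterval, ∃ u : unitInterval, dist (c t) (η u) ≤ ε) → dist (c 0) (η 0) ≤ ε → dist (c 1) (η 1) ≤ ε → (∀ u v : unitInterval, dist (η u) (η v) ≤ 2 * ε + β → dist u v ≤ τ) → (∀ u v : unitInterval, dist u v ≤ τ → dist (η u) (η v) ≤ r₁) → (∀ u v : unitInterval, dist u v ≤ H → dist (η u) (η v) ≤ r₂) → (∀ u v : unitInterval, H / 2 ≤ dist u v → d ≤ dist (η u) (η v)) → dist c η ≤ ε + β + r₁ + r₂ ∨ ∃ s t : Fin 3 → unitInterval, (∀ i, s i ≤ t i) ∧ t 0 < s 1 ∧ t 1 < s 2 ∧ (∀ i, d - 2 * (ε + β + r₁) ≤ Metric.diam ((⇑c) '' Set.Icc (s i) (t i))) ∧ ∀ i j, Metric.hausdorffDist ((⇑c)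 '' Set.Icc (s i) (t i)) ((⇑c) '' Set.Icc (s j) (t j)) ≤ 2 * (ε + β + r₁) := by
  intro c η ε β τ r₁ H r₂ d hβ hH hnear h0 h1 hinj hosc₁ hosc₂ hsep
  obtain ⟨q, hq, hq0, hq1, hclose⟩ := exists_continuous_projection' c η hβ hnear h0 h1 hinj hosc₁
  rcases dist_le_or_exists_strands c η hq hq0 hq1 hH hclose hosc₂ with hle | ⟨s, t, hst, h01, h12,
    L₁, L₂, hL12, himg⟩
  · exact Or.inl (by linarith)
  · have hL : L₁ ≤ L₂ := Subtype.coe_le_coe.1 (by linarith)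
    have hdL : H / 2 ≤ dist L₁ L₂ := by
      rw [Subtype.dist_eq, dist_comm, Real.dist_eq, abs_of_nonneg (by linarith)]
      linarith
    obtain ⟨hdiam, hHd⟩ :=
      diam_and_hausdorffDist_of_strands c η hclose hst hL himg (hsep L₁ L₂ hdL)
    exact Or.inr ⟨s, t, hst, h01, h12, hdiam, hHd⟩

end Summit.CriticalPhenomena.SAWScalingLimit.Theorems.HexConjecture.RootLocality.Upgrade
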